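import Mathlib.MeasureTheory.Measure.Real
import HarnessLib

/-!
# The chain bound: multiplying conditional one-step bounds along a path

Topic `Probability/Process`; theorems only, folklore. If `(G i)_{i ∈ ℕ}` is an increasing sequence of
σ-algebras, `F i ∈ G i` are events and, for every `i`, the conditional probability of `F (i+1)`
given `G i` is at most `w i` on `F i` — in set form: `P(A ∩ F i ∩ F (i+1)) ≤ w i · P(A ∩ F i)` for
every `A ∈ G i` — then

  `P(F 0 ∩ F 1 ∩ ⋯ ∩ F n) ≤ P(F 0) · w 0 · w 1 ⋯ w (n-1)`

(`measure_biInter_le_mul_prod`, real-valued `measureReal_biInter_le_mul_prod`; with a discrete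
"state" attached to each step and transition weights `q i s s'`, `measure_path_le`,
`measureReal_path_le`). The proof is the obvious induction (tower property in set form, no
conditional expectations needed).

This is the book-keeping step by which multi-scale estimates for random curves are assembled from
conditional one-step bounds at stopping times `S₁ ≤ S₂ ≤ ⋯` (`G i = 𝓕_{S_i}`): V. Beffara, *The
dimension of the SLE curves*, Ann. Probab. 36 (2008), proof of Lemma 8 (ii) ("applying the strong
Markov property at each of the times [...] we get an estimate of the conditional probability [...]
that `γ` succeeds with this particular ordering, as a product of conditional probabilities") and
§3.2 ("the probability that a given path occurs [...] will be given by the product along the path of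
the (conditional, given the past) probabilities of the individual steps"); G. F. Lawler,
B. M. Werness, *Multi-point Green's functions for SLE and an estimate of Beffara*, Ann. Probab. 41
(2013), proof of Prop. 4.14 ("we need only multiply through each of these `k` individual
probabilities"). The sum over paths is then a plain union bound (`measure_biUnion_le`).

## References

* V. Beffara, *The dimension of the SLE curves*, Ann. Probab. 36 (2008) 1421–1452, §3.1 (proof of
  Lemma 8 (ii)), §3.2. [Beffara2008]
* G. F. Lawler, B. M. Werness, *Multi-point Green's functions for SLE and an estimate of Beffara*,
  Ann. Probab. 41 (2013) 1513–1555, arXiv:1011.3551, Prop. 4.14. [LawlerWerness2010]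
-/

noncomputable section

open Set MeasureTheory

open scoped ENNReal

namespace Literature.Probability.Process

variable {Ω : Type*} {mΩ : MeasurableSpace Ω}

/-- `⋂_{i ≤ 0} F i = F 0`. [folklore] -/
theorem biInter_le_zero (F : ℕ → Set Ω) : (⋂ i ≤ 0, F i) = F 0 := by
  ext ω
  simp only [mem_iInter]
  exact ⟨fun h ↦ h 0 le_rfl, fun h i hi ↦ by rwa [Nat.le_zero.mp hi]⟩

/-- `⋂_{i ≤ n+1} F i = (⋂_{i ≤ n} F i) ∩ F (n+1)`. [folklore] -/
theorem biInter_le_succ (F : ℕ → Set Ω) (n : ℕ) :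
    (⋂ i ≤ n + 1, F i) = (⋂ i ≤ n, F i) ∩ F (n + 1) := by
  ext ω
  simp only [mem_iInter, mem_inter_iff]
  constructor
  · exact fun h ↦ ⟨fun i hi ↦ h i (hi.trans n.le_succ), h _ le_rfl⟩
  · rintro ⟨h, h'⟩ i hi
    rcases Nat.of_le_succ hi with hi' | rfl
    exacts [h i hi', h']

/-- `⋂_{i ≤ n} F i ⊆ F n`, so `(⋂_{i ≤ n} F i) ∩ F n = ⋂_{i ≤ n} F i`. [folklore] -/
theorem biInter_le_inter_self (F : ℕ → Set Ω) (n : ℕ) :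
    (⋂ i ≤ n, F i) ∩ F n = ⋂ i ≤ n, F i :=
  inter_eq_left.2 (biInter_subset_of_mem (show n ∈ {i | i ≤ n} from le_refl n))

/-- The events `⋂_{i ≤ n} F i` are `G n`-measurable when `F i ∈ G i` and `G` is increasing.
[folklore] -/
theorem measurableSet_biInter_le {G : ℕ → MeasurableSpace Ω} (hmono : Monotone G) {F : ℕ → Set Ω}
    (hF : ∀ i, MeasurableSet[G i] (F i)) (n : ℕ) : MeasurableSet[G n] (⋂ i ≤ n, F i) :=
  MeasurableSet.iInter fun i ↦ MeasurableSet.iInter fun hi ↦ hmono hi _ (hF i)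

/-- **The chain bound.** Let `G` be an increasing sequence of σ-algebras on `Ω`, `F i ∈ G i`, and
suppose that for every `i` and every `A ∈ G i`, `P(A ∩ F i ∩ F (i+1)) ≤ w i · P(A ∩ F i)` (the
conditional probability of the next event given `G i` is at most `w i` on `F i`). Then
`P(⋂_{i ≤ n} F i) ≤ P(F 0) · ∏_{i < n} w i`. [folklore] [cite: Beffara2008, §3.2]
[cite: LawlerWerness2010, Prop. 4.14] -/
theorem measure_biInter_le_mul_prod (P : Measure Ω) {G : ℕ → MeasurableSpace Ω} (hmono : Monotone G)
    {F : ℕ → Set Ω} (hF : ∀ i, MeasurableSet[G i] (F i)) {w : ℕ → ℝ≥0∞}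
    (hw : ∀ i (A : Set Ω), MeasurableSet[G i] A → P (A ∩ F i ∩ F (i + 1)) ≤ w i * P (A ∩ F i))
    (n : ℕ) : P (⋂ i ≤ n, F i) ≤ P (F 0) * ∏ i ∈ Finset.range n, w i := by
  induction n with
  | zero => simp
  | succ n ih =>
    calc P (⋂ i ≤ n + 1, F i) = P ((⋂ i ≤ n, F i) ∩ F n ∩ F (n + 1)) := by
          rw [biInter_le_succ, biInter_le_inter_self]
      _ ≤ w n * P ((⋂ i ≤ n, F i) ∩ F n) := hw n _ (measurableSet_biInter_le hmono hF n)
      _ = w n * P (⋂ i ≤ n, F i) := by rw [biInter_le_inter_self]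
      _ ≤ w n * (P (F 0) * ∏ i ∈ Finset.range n, w i) := by gcongr
      _ = P (F 0) * ∏ i ∈ Finset.range (n + 1), w i := by rw [Finset.prod_range_succ]; ring

/-- **The chain bound, real-valued** (finite measure, nonnegative weights): under
`P.real (A ∩ F i ∩ F (i+1)) ≤ w i · P.real (A ∩ F i)` for all `A ∈ G i`,
`P.real (⋂_{i ≤ n} F i) ≤ P.real (F 0) · ∏_{i < n} w i`. [folklore] [cite: Beffara2008, §3.2]
[cite: LawlerWerness2010, Prop. 4.14] -/
theorem measureReal_biInter_le_mul_prod (P : Measure Ω) {G : ℕ → MeasurableSpace Ω}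
    (hmono : Monotone G) {F : ℕ → Set Ω} (hF : ∀ i, MeasurableSet[G i] (F i)) {w : ℕ → ℝ}
    (hw0 : ∀ i, 0 ≤ w i)
    (hw : ∀ i (A : Set Ω), MeasurableSet[G i] A →
      P.real (A ∩ F i ∩ F (i + 1)) ≤ w i * P.real (A ∩ F i))
    (n : ℕ) : P.real (⋂ i ≤ n, F i) ≤ P.real (F 0) * ∏ i ∈ Finset.range n, w i := by
  induction n with
  | zero => simp
  | succ n ih =>
    calc P.real (⋂ i ≤ n + 1, F i) = P.real ((⋂ i ≤ n, F i) ∩ F n ∩ F (n + 1)) := by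
          rw [biInter_le_succ, biInter_le_inter_self]
      _ ≤ w n * P.real ((⋂ i ≤ n, F i) ∩ F n) := hw n _ (measurableSet_biInter_le hmono hF n)
      _ = w n * P.real (⋂ i ≤ n, F i) := by rw [biInter_le_inter_self]
      _ ≤ w n * (P.real (F 0) * ∏ i ∈ Finset.range n, w i) :=
          mul_le_mul_of_nonneg_left ih (hw0 n)
      _ = P.real (F 0) * ∏ i ∈ Finset.range (n + 1), w i := by rw [Finset.prod_range_succ]; ring

/-- **The probability of a given path** (discrete states). Let `E i s` (`s : S`) be `G i`-measurable
events ("the `i`-th step lands in state `s`") with one-step bounds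
`P(A ∩ E i s ∩ E (i+1) s') ≤ q i s s' · P(A ∩ E i s)` for all `A ∈ G i`. Then for every path
`p : ℕ → S`, `P(⋂_{i ≤ n} E i (p i)) ≤ P(E 0 (p 0)) · ∏_{i < n} q i (p i) (p (i+1))` (Beffara:
"the probability that a given path occurs [...] will be given by the product along the path of the
(conditional, given the past) probabilities of the individual steps"). [folklore] [cite: Beffara2008, §3.2]
[cite: LawlerWerness2010, Prop. 4.14] -/
theorem measure_path_le {S : Type*} (P : Measure Ω) {G : ℕ → MeasurableSpace Ω} (hmono : Monotone G)
    {E : ℕ → S → Set Ω} (hE : ∀ i s, MeasurableSet[G i] (E i s)) {q : ℕ → S → S → ℝ≥0∞}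
    (hq : ∀ i s s' (A : Set Ω), MeasurableSet[G i] A →
      P (A ∩ E i s ∩ E (i + 1) s') ≤ q i s s' * P (A ∩ E i s))
    (p : ℕ → S) (n : ℕ) :
    P (⋂ i ≤ n, E i (p i)) ≤ P (E 0 (p 0)) * ∏ i ∈ Finset.range n, q i (p i) (p (i + 1)) :=
  measure_biInter_le_mul_prod P hmono (fun i ↦ hE i (p i)) (fun i A hA ↦ hq i _ _ A hA) n

/-- **The probability of a given path, real-valued.** [folklore] [cite: Beffara2008, §3.2]
[cite: LawlerWerness2010, Prop. 4.14] -/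
theorem measureReal_path_le {S : Type*} (P : Measure Ω) {G : ℕ → MeasurableSpace Ω}
    (hmono : Monotone G) {E : ℕ → S → Set Ω} (hE : ∀ i s, MeasurableSet[G i] (E i s))
    {q : ℕ → S → S → ℝ} (hq0 : ∀ i s s', 0 ≤ q i s s')
    (hq : ∀ i s s' (A : Set Ω), MeasurableSet[G i] A →
      P.real (A ∩ E i s ∩ E (i + 1) s') ≤ q i s s' * P.real (A ∩ E i s))
    (p : ℕ → S) (n : ℕ) :
    P.real (⋂ i ≤ n, E i (p i)) ≤
      P.real (E 0 (p 0)) * ∏ i ∈ Finset.range n, q i (p i) (p (i + 1)) :=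
  measureReal_biInter_le_mul_prod P hmono (fun i ↦ hE i (p i)) (fun i ↦ hq0 i _ _)
    (fun i A hA ↦ hq i _ _ A hA) n

/-- **Summing over paths** (union bound): if an event is covered by the paths of a countable family
`𝒫`, each followed for `len p` steps, its probability is at most the sum over `𝒫` of the path
products. [folklore]
[cite: Beffara2008, §3.2] [cite: LawlerWerness2010, §4.4] -/
theorem measure_le_tsum_paths {S ι : Type*} [Countable ι] (P : Measure Ω) {G : ℕ → MeasurableSpace Ω}
    (hmono : Monotone G) {E : ℕ → S → Set Ω} (hE : ∀ i s, MeasurableSet[G i] (E i s))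
    {q : ℕ → S → S → ℝ≥0∞}
    (hq : ∀ i s s' (A : Set Ω), MeasurableSet[G i] A →
      P (A ∩ E i s ∩ E (i + 1) s') ≤ q i s s' * P (A ∩ E i s))
    (path : ι → ℕ → S) (len : ι → ℕ) {V : Set Ω}
    (hV : V ⊆ ⋃ k, ⋂ i ≤ len k, E i (path k i)) :
    P V ≤ ∑' k, P (E 0 (path k 0)) * ∏ i ∈ Finset.range (len k), q i (path k i) (path k (i + 1)) :=
  calc P V ≤ P (⋃ k, ⋂ i ≤ len k, E i (path k i)) := measure_mono hV
    _ ≤ ∑' k, P (⋂ i ≤ len k, E i (path k i)) := measure_iUnion_le _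
    _ ≤ ∑' k, P (E 0 (path k 0)) * ∏ i ∈ Finset.range (len k), q i (path k i) (path k (i + 1)) :=
        ENNReal.tsum_le_tsum fun k ↦ measure_path_le P hmono hE hq (path k) (len k)

end Literature.Probability.Process
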